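import Mathlib
import HarnessLib

/-!
# Multisymmetric polynomials are generated by the polarized power sums (ORBIT currency, positive lane of A_∞)

Route MonotoneRestoration, crux `OrbitRestorationQP` (stmt-ValiantsHypothesis-18293), line `depth-three-rung`, registered stub
`stub_sigmaPiSigmaValue` (A_∞).  Namespace `Summit.ValiantsHypothesis.ValiantsHypothesis.Theorems.MultisymmetricPowerSums`.
Definition-free.

The two-level stratum of A_∞ (`Theorems/…RowColumnTwoLevel.lean`: matrix-symmetric elements of `ℂ[g(row_i), g'(col_j)]` are
`QPOrbitRestorable 12`) uses ONE symmetric statistic per row and Mathlib's fundamental theorem of symmetric polynomials.  Several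
statistics `g_1, …, g_d` per row lead, after one-block symmetrisation, to a polynomial in the `n · d` quantities `y_{ik} = g_k(row_i)`
that is MULTISYMMETRIC (invariant under simultaneous permutation of the rows `y_i = (y_{i1}, …, y_{id})`), and the missing input
(named in the repair census of hand -4 g2) is the **first fundamental theorem for vector invariants of `Sym_n`** (Schläfli, Noether,
Weyl): over a ring containing `ℚ`, the multisymmetric polynomials are generated by the POLARIZED POWER SUMS
`F_α = Σ_i Π_k y_{ik}^{α_k}` (`α ∈ ℕ^d`).  This file proves it, over any commutative algebra `B` over a field `K` of characteristic
`0`, for the polynomial ring `B[y_{ik} : i < n, k ∈ κ]` with `Sym_n` permuting the row index: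

* `rename_row_mono`, `rename_row_powerSum`, `rsum_rename`, `rsum_mono_comp`, `mul_rsum` — the row action on monomials
  `y^b = Π_i Π_k y_{ik}^{b i k}`, invariance of `F_α`, and the orbit sum `R q = Σ_σ σ·q` (`R (τ·q) = R q`, `q · R p = R (q p)` for
  invariant `q`);
* `mono_update_add`, `powerSum_mul_mono` — the multiplication rule `F_γ · y^c = Σ_i y^{c[i ↦ c_i + γ]}`;
* `rsum_mono_mem_adjoin_powerSums` — **KEY** (induction on the number of non-zero rows of `b`): `R (y^b) ∈ B[F_α : α]`; in the
  inductive step `F_γ · R(y^{b'}) = #{i : b'_i = 0} · R(y^b) + Σ_{i : b'_i ≠ 0} R(y^{b'[i ↦ b'_i + γ]})` with `b'` = `b` with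
  its row `i₀` (`γ = b_{i₀} ≠ 0`) removed, and the positive integer is inverted in `K`;
* `mem_adjoin_powerSums_of_rowSymmetric` — **THE THEOREM**: every row-symmetric `P ∈ B[y_{ik}]` lies in `B[F_α : α ∈ ℕ^κ]`
  (`n! · P = R P = Σ_d coeff_d · R(y^d)`).

Calibration: a classical theorem (the `d = 1` case is Newton / the fundamental theorem of symmetric polynomials, in Mathlib); not in
Mathlib for `d ≥ 2`; stated in Mathlib's `MvPolynomial` vocabulary without new definitions so that the d-statistics version of the
two-level stratum can be assembled exactly like `…RowColumnTwoLevel.lean`.  Nothing here bears on VP ≠ VNP.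
[cite: Weyl1939, Chap. II §3, Thm (2.3.A); Domokos2009, §1 remark (ii)]

## References
* H. Weyl, *The Classical Groups*, Princeton (1939; 2nd ed. 1946), Chap. II §3, Theorem (2.3.A) (symmetric functions of several
  vectors are polynomials in the polarized elementary symmetric functions; in characteristic `0` equivalently in the polarized power
  sums). [Weyl1939]
* M. Domokos, *Vector invariants of a class of pseudo-reflection groups and multisymmetric syzygies*, J. Lie Theory 19 (2009),
  §1 remark (ii) (history of the theorem). [Domokos2009]
* A. Dawar, G. Wilsenach, *Symmetric arithmetic circuits*, ToC 21 (2025), §3.3. [DawarWilsenach2025]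
-/

noncomputable section

open scoped Classical

-- `Summit.ValiantsHypothesis.ValiantsHypothesis.…` is the tree's single-conjunct layout (Sub = Summit).
set_option linter.dupNamespace false

namespace Summit.ValiantsHypothesis.ValiantsHypothesis.Theorems

namespace MultisymmetricPowerSums

open MvPolynomial Equiv

variable {B : Type*} [CommRing B] {n : ℕ} {κ : Type*} [Fintype κ]

/-! ### The row action on monomials and power sums -/

/-- `σ · y^b = y^{b ∘ σ⁻¹}` for the row action `y_{ik} ↦ y_{σ i, k}`. [folklore] -/
theorem rename_row_mono (σ : Perm (Fin n)) (b : Fin n → κ → ℕ) :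
    rename (fun w : Fin n × κ => (σ w.1, w.2)) (∏ i : Fin n, ∏ k : κ, (X (i, k) : MvPolynomial (Fin n × κ) B) ^ b i k) =
      ∏ i : Fin n, ∏ k : κ, (X (i, k) : MvPolynomial (Fin n × κ) B) ^ b (σ.symm i) k := by
  simp only [map_prod, map_pow, rename_X]
  rw [← Equiv.prod_comp σ (fun i => ∏ k : κ, (X (i, k) : MvPolynomial (Fin n × κ) B) ^ b (σ.symm i) k)]
  simp only [Equiv.symm_apply_apply]

/-- The polarized power sum `F_γ = Σ_i Π_k y_{ik}^{γ_k}` is row-symmetric. [folklore] -/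
theorem rename_row_powerSum (σ : Perm (Fin n)) (γ : κ → ℕ) :
    rename (fun w : Fin n × κ => (σ w.1, w.2)) (∑ i : Fin n, ∏ k : κ, (X (i, k) : MvPolynomial (Fin n × κ) B) ^ γ k) =
      ∑ i : Fin n, ∏ k : κ, (X (i, k) : MvPolynomial (Fin n × κ) B) ^ γ k := by
  simp only [map_sum, map_prod, map_pow, rename_X]
  exact Equiv.sum_comp σ (fun i => ∏ k : κ, (X (i, k) : MvPolynomial (Fin n × κ) B) ^ γ k)

omit [Fintype κ] in
/-- The orbit sum `R q = Σ_σ σ·q` is invariant under right translation: `R (τ · q) = R q`. [folklore] -/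
theorem rsum_rename (τ : Perm (Fin n)) (q : MvPolynomial (Fin n × κ) B) :
    (∑ σ : Perm (Fin n), rename (fun w : Fin n × κ => (σ w.1, w.2)) (rename (fun w : Fin n × κ => (τ w.1, w.2)) q)) =
      ∑ σ : Perm (Fin n), rename (fun w : Fin n × κ => (σ w.1, w.2)) q := by
  simp only [rename_rename]
  have hcomp : ∀ σ : Perm (Fin n), ((fun w : Fin n × κ => (σ w.1, w.2)) ∘ fun w : Fin n × κ => (τ w.1, w.2)) =
      fun w : Fin n × κ => ((σ * τ) w.1, w.2) := fun σ => funext fun w => by simp [Perm.mul_apply]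
  simp_rw [hcomp]
  exact Fintype.sum_equiv (Equiv.mulRight τ) _ _ (fun σ => rfl)

/-- `R (y^{b ∘ π}) = R (y^b)`. [folklore] -/
theorem rsum_mono_comp (π : Perm (Fin n)) (b : Fin n → κ → ℕ) :
    (∑ σ : Perm (Fin n), rename (fun w : Fin n × κ => (σ w.1, w.2))
        (∏ i : Fin n, ∏ k : κ, (X (i, k) : MvPolynomial (Fin n × κ) B) ^ b (π i) k)) =
      ∑ σ : Perm (Fin n), rename (fun w : Fin n × κ => (σ w.1, w.2))
        (∏ i : Fin n, ∏ k : κ, (X (i, k) : MvPolynomial (Fin n × κ) B) ^ b i k) := by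
  have h := rename_row_mono (B := B) π⁻¹ b
  simp only [Equiv.Perm.inv_def, Equiv.symm_symm] at h
  rw [← h]
  exact rsum_rename π.symm _

omit [Fintype κ] in
/-- `q · R p = R (q · p)` for a row-symmetric `q`. [folklore] -/
theorem mul_rsum (q p : MvPolynomial (Fin n × κ) B)
    (hq : ∀ σ : Perm (Fin n), rename (fun w : Fin n × κ => (σ w.1, w.2)) q = q) :
    q * (∑ σ : Perm (Fin n), rename (fun w : Fin n × κ => (σ w.1, w.2)) p) =
      ∑ σ : Perm (Fin n), rename (fun w : Fin n × κ => (σ w.1, w.2)) (q * p) := by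
  rw [Finset.mul_sum]
  exact Finset.sum_congr rfl fun σ _ => by rw [map_mul, hq σ]

/-! ### The multiplication rule -/

/-- Splitting off one row: `y^{c[i ↦ c_i + δ]} = y^c · Π_k y_{ik}^{δ_k}`. [folklore] -/
theorem mono_update_add (c : Fin n → κ → ℕ) (i : Fin n) (δ : κ → ℕ) :
    (∏ i' : Fin n, ∏ k : κ, (X (i', k) : MvPolynomial (Fin n × κ) B) ^ Function.update c i (c i + δ) i' k) =
      (∏ i' : Fin n, ∏ k : κ, (X (i', k) : MvPolynomial (Fin n × κ) B) ^ c i' k) *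
        ∏ k : κ, (X (i, k) : MvPolynomial (Fin n × κ) B) ^ δ k := by
  rw [← Finset.mul_prod_erase Finset.univ
      (fun i' => ∏ k : κ, (X (i', k) : MvPolynomial (Fin n × κ) B) ^ Function.update c i (c i + δ) i' k) (Finset.mem_univ i),
    ← Finset.mul_prod_erase Finset.univ (fun i' => ∏ k : κ, (X (i', k) : MvPolynomial (Fin n × κ) B) ^ c i' k)
      (Finset.mem_univ i)]
  have h : ∀ i' ∈ Finset.univ.erase i,
      (∏ k : κ, (X (i', k) : MvPolynomial (Fin n × κ) B) ^ Function.update c i (c i + δ) i' k) =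
        ∏ k : κ, (X (i', k) : MvPolynomial (Fin n × κ) B) ^ c i' k := by
    intro i' hi'
    rw [Function.update_of_ne (Finset.ne_of_mem_erase hi')]
  rw [Finset.prod_congr rfl h, Function.update_self]
  simp only [Pi.add_apply, pow_add, Finset.prod_mul_distrib]
  ring

/-- **Multiplication rule**: `F_γ · y^c = Σ_i y^{c[i ↦ c_i + γ]}`. [folklore] -/
theorem powerSum_mul_mono (γ : κ → ℕ) (c : Fin n → κ → ℕ) :
    (∑ i : Fin n, ∏ k : κ, (X (i, k) : MvPolynomial (Fin n × κ) B) ^ γ k) *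
        (∏ i' : Fin n, ∏ k : κ, (X (i', k) : MvPolynomial (Fin n × κ) B) ^ c i' k) =
      ∑ i : Fin n, ∏ i' : Fin n, ∏ k : κ, (X (i', k) : MvPolynomial (Fin n × κ) B) ^ Function.update c i (c i + γ) i' k := by
  rw [Finset.sum_mul]
  exact Finset.sum_congr rfl fun i _ => by rw [mono_update_add, mul_comm]

/-! ### The orbit sum of every monomial is a polynomial in the polarized power sums -/

/-- **KEY.**  For every exponent matrix `b`, the orbit sum `R (y^b) = Σ_σ σ · y^b` lies in the `B`-subalgebra generated by the
polarized power sums `F_α = Σ_i Π_k y_{ik}^{α_k}` (induction on the number `r` of non-zero rows of `b`; `K` a field of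
characteristic `0` mapping to `B`). [cite: Weyl1939, Chap. II §3, Thm (2.3.A); Domokos2009, §1 remark (ii)] -/
theorem rsum_mono_mem_adjoin_powerSums_aux (K : Type*) [Field K] [CharZero K] [Algebra K B] (r : ℕ) :
    ∀ b : Fin n → κ → ℕ, (Finset.univ.filter fun i => b i ≠ 0).card = r →
      (∑ σ : Perm (Fin n), rename (fun w : Fin n × κ => (σ w.1, w.2))
          (∏ i : Fin n, ∏ k : κ, (X (i, k) : MvPolynomial (Fin n × κ) B) ^ b i k)) ∈
        Algebra.adjoin B (Set.range fun α : κ → ℕ =>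
          ∑ i : Fin n, ∏ k : κ, (X (i, k) : MvPolynomial (Fin n × κ) B) ^ α k) := by
  induction r using Nat.strong_induction_on with
  | _ r ih =>
  intro b hb
  rcases (Finset.univ.filter fun i => b i ≠ 0).eq_empty_or_nonempty with he | ⟨i₀, hi₀⟩
  · -- `b = 0`: every term of the orbit sum is `1`
    have hb0 : ∀ i, b i = 0 := by
      intro i
      by_contra h
      have hi : i ∈ Finset.univ.filter fun i => b i ≠ 0 := Finset.mem_filter.2 ⟨Finset.mem_univ _, h⟩
      rw [he] at hi
      exact absurd hi (Finset.notMem_empty _)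
    refine Subalgebra.sum_mem _ fun σ _ => ?_
    have hmono : (∏ i : Fin n, ∏ k : κ, (X (i, k) : MvPolynomial (Fin n × κ) B) ^ b i k) = 1 := by
      simp [hb0]
    rw [hmono, map_one]
    exact one_mem _
  · -- remove the row `i₀`
    have hbi₀ : b i₀ ≠ 0 := (Finset.mem_filter.1 hi₀).2
    have hr : 0 < r := by
      rw [← hb]
      exact Finset.card_pos.2 ⟨i₀, hi₀⟩
    obtain ⟨b', hb'i₀, hb'ne, hrows'⟩ : ∃ b' : Fin n → κ → ℕ, b' i₀ = 0 ∧ (∀ i, i ≠ i₀ → b' i = b i) ∧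
        (Finset.univ.filter fun i => b' i ≠ 0).card = r - 1 := by
      refine ⟨Function.update b i₀ 0, Function.update_self .., fun i hi => Function.update_of_ne hi .., ?_⟩
      have hset : (Finset.univ.filter fun i => Function.update b i₀ 0 i ≠ 0) =
          (Finset.univ.filter fun i => b i ≠ 0).erase i₀ := by
        ext i
        simp only [Finset.mem_filter, Finset.mem_univ, true_and, Finset.mem_erase]
        by_cases hi : i = i₀
        · subst hi
          simp
        · rw [Function.update_of_ne hi]
          exact ⟨fun h => ⟨hi, h⟩, fun h => h.2⟩
      rw [hset, Finset.card_erase_of_mem hi₀, hb]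
    -- abbreviations-free bookkeeping: the generators, the IH for `b'`
    have hF : (∑ i : Fin n, ∏ k : κ, (X (i, k) : MvPolynomial (Fin n × κ) B) ^ b i₀ k) ∈
        Algebra.adjoin B (Set.range fun α : κ → ℕ =>
          ∑ i : Fin n, ∏ k : κ, (X (i, k) : MvPolynomial (Fin n × κ) B) ^ α k) :=
      Algebra.subset_adjoin ⟨b i₀, rfl⟩
    have hA' := ih (r - 1) (by omega) b' hrows'
    -- the multiplication rule, summed over the group
    have key : (∑ i : Fin n, ∏ k : κ, (X (i, k) : MvPolynomial (Fin n × κ) B) ^ b i₀ k) *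
        (∑ σ : Perm (Fin n), rename (fun w : Fin n × κ => (σ w.1, w.2))
          (∏ i : Fin n, ∏ k : κ, (X (i, k) : MvPolynomial (Fin n × κ) B) ^ b' i k)) =
        ∑ i : Fin n, ∑ σ : Perm (Fin n), rename (fun w : Fin n × κ => (σ w.1, w.2))
          (∏ i' : Fin n, ∏ k : κ, (X (i', k) : MvPolynomial (Fin n × κ) B) ^ Function.update b' i (b' i + b i₀) i' k) := by
      rw [mul_rsum _ _ (fun σ => rename_row_powerSum σ (b i₀)), powerSum_mul_mono]
      simp_rw [map_sum]
      exact Finset.sum_comm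
    -- rows `i` with `b' i = 0` contribute `R (y^b)` each
    have h0 : ∀ i ∈ Finset.univ.filter (fun i => b' i = 0),
        (∑ σ : Perm (Fin n), rename (fun w : Fin n × κ => (σ w.1, w.2))
          (∏ i' : Fin n, ∏ k : κ, (X (i', k) : MvPolynomial (Fin n × κ) B) ^ Function.update b' i (b' i + b i₀) i' k)) =
        ∑ σ : Perm (Fin n), rename (fun w : Fin n × κ => (σ w.1, w.2))
          (∏ i' : Fin n, ∏ k : κ, (X (i', k) : MvPolynomial (Fin n × κ) B) ^ b i' k) := by
      intro i hi
      have hb'i : b' i = 0 := (Finset.mem_filter.1 hi).2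
      have hfun : Function.update b' i (b' i + b i₀) = fun j => b (Equiv.swap i i₀ j) := by
        funext j
        by_cases hji : j = i
        · subst hji
          rw [Function.update_self, hb'i, zero_add, Equiv.swap_apply_left]
        · rw [Function.update_of_ne hji]
          by_cases hji₀ : j = i₀
          · have hii₀ : i ≠ i₀ := fun h => hji (hji₀.trans h.symm)
            rw [hji₀, Equiv.swap_apply_right, hb'i₀]
            exact ((hb'ne i hii₀).symm.trans hb'i).symm
          · rw [Equiv.swap_apply_of_ne_of_ne hji hji₀, hb'ne j hji₀]
      rw [hfun]
      exact rsum_mono_comp (Equiv.swap i i₀) b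
    -- rows `i` with `b' i ≠ 0` contribute elements covered by the induction hypothesis
    have h1 : ∀ i ∈ Finset.univ.filter (fun i => ¬ b' i = 0),
        (∑ σ : Perm (Fin n), rename (fun w : Fin n × κ => (σ w.1, w.2))
          (∏ i' : Fin n, ∏ k : κ, (X (i', k) : MvPolynomial (Fin n × κ) B) ^ Function.update b' i (b' i + b i₀) i' k)) ∈
        Algebra.adjoin B (Set.range fun α : κ → ℕ =>
          ∑ i : Fin n, ∏ k : κ, (X (i, k) : MvPolynomial (Fin n × κ) B) ^ α k) := by
      intro i hi
      have hb'i : b' i ≠ 0 := (Finset.mem_filter.1 hi).2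
      refine ih (r - 1) (by omega) _ ?_
      rw [← hrows']
      congr 1
      ext j
      simp only [Finset.mem_filter, Finset.mem_univ, true_and]
      by_cases hji : j = i
      · subst hji
        rw [Function.update_self]
        refine ⟨fun _ => hb'i, fun _ h => hb'i (funext fun k => ?_)⟩
        have hk := congrFun h k
        simp only [Pi.add_apply, Pi.zero_apply] at hk
        show b' j k = 0
        omega
      · rw [Function.update_of_ne hji]
    -- assemble: `#{i : b' i = 0} • R (y^b) ∈ B[F]`
    have hsplit := Finset.sum_filter_add_sum_filter_not Finset.univ (fun i => b' i = 0)
      (fun i => ∑ σ : Perm (Fin n), rename (fun w : Fin n × κ => (σ w.1, w.2))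
        (∏ i' : Fin n, ∏ k : κ, (X (i', k) : MvPolynomial (Fin n × κ) B) ^ Function.update b' i (b' i + b i₀) i' k))
    rw [Finset.sum_congr rfl h0, Finset.sum_const, ← key] at hsplit
    have hmem : (Finset.univ.filter fun i => b' i = 0).card •
        (∑ σ : Perm (Fin n), rename (fun w : Fin n × κ => (σ w.1, w.2))
          (∏ i' : Fin n, ∏ k : κ, (X (i', k) : MvPolynomial (Fin n × κ) B) ^ b i' k)) ∈
        Algebra.adjoin B (Set.range fun α : κ → ℕ =>
          ∑ i : Fin n, ∏ k : κ, (X (i, k) : MvPolynomial (Fin n × κ) B) ^ α k) := by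
      rw [eq_sub_of_add_eq hsplit]
      exact Subalgebra.sub_mem _ (Subalgebra.mul_mem _ hF hA') (Subalgebra.sum_mem _ h1)
    have hS0 : (Finset.univ.filter fun i => b' i = 0).card ≠ 0 :=
      Finset.card_ne_zero.2 ⟨i₀, Finset.mem_filter.2 ⟨Finset.mem_univ _, hb'i₀⟩⟩
    -- invert the positive integer in `K`
    have hinv : (∑ σ : Perm (Fin n), rename (fun w : Fin n × κ => (σ w.1, w.2))
          (∏ i' : Fin n, ∏ k : κ, (X (i', k) : MvPolynomial (Fin n × κ) B) ^ b i' k)) =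
        algebraMap K (MvPolynomial (Fin n × κ) B) (((Finset.univ.filter fun i => b' i = 0).card : K)⁻¹) *
          ((Finset.univ.filter fun i => b' i = 0).card •
            ∑ σ : Perm (Fin n), rename (fun w : Fin n × κ => (σ w.1, w.2))
              (∏ i' : Fin n, ∏ k : κ, (X (i', k) : MvPolynomial (Fin n × κ) B) ^ b i' k)) := by
      rw [← Nat.cast_smul_eq_nsmul K, Algebra.smul_def, ← mul_assoc, ← map_mul,
        inv_mul_cancel₀ (Nat.cast_ne_zero.2 hS0), map_one, one_mul]
    rw [hinv]
    refine Subalgebra.mul_mem _ ?_ hmem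
    rw [IsScalarTower.algebraMap_apply K B (MvPolynomial (Fin n × κ) B)]
    exact Subalgebra.algebraMap_mem _ _

/-- The orbit sum of every monomial lies in `B[F_α : α]`. [cite: Weyl1939, Chap. II §3, Thm (2.3.A); Domokos2009, §1 remark (ii)] -/
theorem rsum_mono_mem_adjoin_powerSums (K : Type*) [Field K] [CharZero K] [Algebra K B] (b : Fin n → κ → ℕ) :
    (∑ σ : Perm (Fin n), rename (fun w : Fin n × κ => (σ w.1, w.2))
        (∏ i : Fin n, ∏ k : κ, (X (i, k) : MvPolynomial (Fin n × κ) B) ^ b i k)) ∈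
      Algebra.adjoin B (Set.range fun α : κ → ℕ =>
        ∑ i : Fin n, ∏ k : κ, (X (i, k) : MvPolynomial (Fin n × κ) B) ^ α k) :=
  rsum_mono_mem_adjoin_powerSums_aux K _ b rfl

/-! ### The first fundamental theorem for multisymmetric polynomials -/

/-- A monomial of `B[y_{ik}]` as a constant times a row-by-row product. [folklore] -/
theorem monomial_eq_C_mul_mono (d : (Fin n × κ) →₀ ℕ) (c : B) :
    (monomial d c : MvPolynomial (Fin n × κ) B) =
      C c * ∏ i : Fin n, ∏ k : κ, (X (i, k) : MvPolynomial (Fin n × κ) B) ^ d (i, k) := by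
  rw [monomial_eq, Finsupp.prod_fintype _ _ (fun q => pow_zero _), Fintype.prod_prod_type]

/-- The orbit sum of a polynomial, monomial by monomial. [folklore] -/
theorem rsum_eq_sum_support (P : MvPolynomial (Fin n × κ) B) :
    (∑ σ : Perm (Fin n), rename (fun w : Fin n × κ => (σ w.1, w.2)) P) =
      ∑ d ∈ P.support, C (coeff d P) * ∑ σ : Perm (Fin n), rename (fun w : Fin n × κ => (σ w.1, w.2))
        (∏ i : Fin n, ∏ k : κ, (X (i, k) : MvPolynomial (Fin n × κ) B) ^ d (i, k)) := by
  conv_lhs => rw [P.as_sum]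
  simp_rw [map_sum, monomial_eq_C_mul_mono, map_mul, rename_C, Finset.mul_sum]
  exact Finset.sum_comm

/-- **FIRST FUNDAMENTAL THEOREM FOR MULTISYMMETRIC POLYNOMIALS** (vector invariants of the symmetric group, characteristic `0`).
Let `B` be a commutative algebra over a field `K` of characteristic `0`.  Every polynomial `P ∈ B[y_{ik} : i < n, k ∈ κ]` invariant
under all simultaneous row permutations `y_{ik} ↦ y_{σ i, k}` is a polynomial over `B` in the polarized power sums
`F_α = Σ_{i<n} Π_{k∈κ} y_{ik}^{α_k}`, `α : κ → ℕ`. [cite: Weyl1939, Chap. II §3, Thm (2.3.A); Domokos2009, §1 remark (ii)] -/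
theorem mem_adjoin_powerSums_of_rowSymmetric (K : Type*) [Field K] [CharZero K] [Algebra K B]
    (P : MvPolynomial (Fin n × κ) B) (hP : ∀ σ : Perm (Fin n), rename (fun w : Fin n × κ => (σ w.1, w.2)) P = P) :
    P ∈ Algebra.adjoin B (Set.range fun α : κ → ℕ =>
      ∑ i : Fin n, ∏ k : κ, (X (i, k) : MvPolynomial (Fin n × κ) B) ^ α k) := by
  have hR : (∑ σ : Perm (Fin n), rename (fun w : Fin n × κ => (σ w.1, w.2)) P) = (Nat.factorial n) • P := by
    simp_rw [hP]
    rw [Finset.sum_const, Finset.card_univ, Fintype.card_perm, Fintype.card_fin]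
  have hRmem : (Nat.factorial n) • P ∈ Algebra.adjoin B (Set.range fun α : κ → ℕ =>
      ∑ i : Fin n, ∏ k : κ, (X (i, k) : MvPolynomial (Fin n × κ) B) ^ α k) := by
    rw [← hR, rsum_eq_sum_support]
    refine Subalgebra.sum_mem _ fun d _ => Subalgebra.mul_mem _ ?_ (rsum_mono_mem_adjoin_powerSums K fun i k => d (i, k))
    rw [← MvPolynomial.algebraMap_eq]
    exact Subalgebra.algebraMap_mem _ _
  have hinv : P = algebraMap K (MvPolynomial (Fin n × κ) B) ((Nat.factorial n : K)⁻¹) * ((Nat.factorial n) • P) := by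
    rw [← Nat.cast_smul_eq_nsmul K, Algebra.smul_def, ← mul_assoc, ← map_mul,
      inv_mul_cancel₀ (Nat.cast_ne_zero.2 (Nat.factorial_ne_zero n)), map_one, one_mul]
  rw [hinv]
  refine Subalgebra.mul_mem _ ?_ hRmem
  rw [IsScalarTower.algebraMap_apply K B (MvPolynomial (Fin n × κ) B)]
  exact Subalgebra.algebraMap_mem _ _

/-- The theorem over `ℂ` (the case used by the row/column strata of A_∞): a row-symmetric `P ∈ ℂ[y_{ik}]` is a polynomial in the
polarized power sums. [cite: Weyl1939, Chap. II §3, Thm (2.3.A)] -/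
theorem mem_adjoin_powerSums_of_rowSymmetric_complex (P : MvPolynomial (Fin n × κ) ℂ)
    (hP : ∀ σ : Perm (Fin n), rename (fun w : Fin n × κ => (σ w.1, w.2)) P = P) :
    P ∈ Algebra.adjoin ℂ (Set.range fun α : κ → ℕ =>
      ∑ i : Fin n, ∏ k : κ, (X (i, k) : MvPolynomial (Fin n × κ) ℂ) ^ α k) :=
  mem_adjoin_powerSums_of_rowSymmetric ℂ P hP

end MultisymmetricPowerSums

end Summit.ValiantsHypothesis.ValiantsHypothesis.Theorems

end
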